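import Summits.CriticalPhenomena.PercolationContinuityZ3.Theses.PercBoundarySqueeze
import Summits.CriticalPhenomena.PercolationContinuityZ3.Theorems.PercNonProliferationFreeBoxPowerSavingSizeSplitting
import Summits.CriticalPhenomena.PercolationContinuityZ3.Theorems.PercNonProliferationFreeBoxPowerSavingLogBoost
import Summits.CriticalPhenomena.PercolationContinuityZ3.Theorems.FreeBoxPowerSaving.Negative.TightnessCollapseStubGuards

/-!
# Crux `PercNonProliferation.FreeBoxPowerSaving` (stmt-CriticalPhenomena-4447):
# the sibling crux `PercBoundarySqueeze.FreeBoxFatClusterMass` (stmt-CriticalPhenomena-6982) implies it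

Helper file for the crux chain of `FreeBoxPowerSaving` (line `boundary-interior-split-fat-finite-clusters`),
landed `--supports stmt-CriticalPhenomena-4447`.  It kernel-checks a cross-route edge of the statement DAG:

  `PercBoundarySqueeze.FreeBoxFatClusterMass` (r2 of route PercBoundarySqueeze, stmt-6982)
  `⟹ QG-NAS ⟹ PercNonProliferation.FreeBoxPowerSaving` (stmt-4447).

Notation: bond percolation `P_p` on `ℤ³`, free box `Λ_n = box 3 n`, in-box piece
`C_n(u) = {v ∈ Λ_n : u ↔ v inside Λ_n}`, `QG(n, t) = {∃ u ∈ Λ_n, |C_n(u)| ≥ t}`.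
`FreeBoxFatClusterMass` says `Σ_{x ∈ Λ_R} P_{p_c}(|C_R(x)| ≥ ⌊√(R³)⌋) ≤ C R^{3-δ}` for some `δ > 0`
(the expected NUMBER of vertices of `Λ_R` lying in fat in-box pieces has a power saving).

* `OfFatClusterMass.le_sum_indicator` (pointwise): on `QG(n, t)` with `t ≥ ⌊√(n³)⌋`, at least `t`
  vertices `x ∈ Λ_n` have `|C_n(x)| ≥ ⌊√(n³)⌋` — every vertex of the fat piece is such a vertex,
  because `↔ inside Λ_n` is an equivalence relation.
* `OfFatClusterMass.measureReal_quasiGiant_le_sum_div` (first-moment Markov, every `p`):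
  `P_p(QG(n, t)) ≤ t⁻¹ Σ_{x ∈ Λ_n} P_p(|C_n(x)| ≥ ⌊√(n³)⌋)` for `t > 0`, `t ≥ ⌊√(n³)⌋`.
* `OfFatClusterMass.quasiGiantNotAS_of_freeBoxFatClusterMass`: with `a = min δ 2 / 2` the threshold
  `t = n^{3-a} ≥ n² ≥ ⌊√(n³)⌋` gives `P_{p_c}(QG(n, n^{3-a})) ≤ C n^{a-δ} ≤ C n^{-a} ≤ 1/2`
  eventually — VERBATIM the one-bit hypothesis (QG-NAS) of the landed `stub_logBoost` (p79965).
* `freeBoxPowerSaving_of_freeBoxFatClusterMass`: compose with the landed `stub_sizeSplitting`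
  (p77722), `stub_logBoost` (p79965) and `FreeBoxPowerSavingNegative.of_eventually` (p73056).

So stmt-6982 joins `OneArmPowerDecay`, `PercTwoPointDecay.CritBallAverageDecay` (stmt-0833) and
`PercShatteringRace.FreeSusceptibilityPowerSaving` (stmt-5786) in the cone of sufficient conditions
for the crux (`Cruxes/FreeBoxPowerSaving/Disproof.lean` §6, §8, §10); unlike those three it is a
statement about the VOLUME of in-box pieces, not about two-point sums, and the implication runs
through the one-bit boost rather than through a termwise comparison.  The converse is not claimed
(the crux gives `Σ_x P(|C_n(x)| ≥ n^{3/2}) ≤ C n^{9/2-a}` by Markov, a saving only if `a > 3/2`).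
Degenerate parameters: `δ > 2` is first cut down to `min δ 2` (the hypothesis is monotone in `δ`
for `R ≥ 1`); `n = 0` is excluded by `∀ᶠ`.
-/

noncomputable section

open MeasureTheory Filter Topology
open scoped Classical
open Literature.Probability.Percolation Literature.Probability.LatticeModels

namespace Summit.CriticalPhenomena.PercolationContinuityZ3.FreeBoxPowerSavingLine

namespace OfFatClusterMass

/-- **Every vertex of a fat piece is fat** (pointwise).  If some `u ∈ Λ_n` has
`|C_n(u)| ≥ t ≥ ⌊√(n³)⌋`, then at least `t` vertices `x ∈ Λ_n` satisfy `|C_n(x)| ≥ ⌊√(n³)⌋`: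
for `x ∈ C_n(u)` one has `C_n(u) ⊆ C_n(x)` since `↔ inside Λ_n` is symmetric and transitive. -/
theorem le_sum_indicator {n : ℕ} {t : ℝ} (ht : ((Nat.sqrt (n ^ 3) : ℕ) : ℝ) ≤ t)
    {ω : BondConfig (Site 3)}
    (hω : ∃ u ∈ box 3 n,
      t ≤ (((box 3 n).filter fun v => ω ∈ openConnIn ↑(box 3 n) u v).card : ℝ)) :
    t ≤ ∑ x ∈ box 3 n,
      {ω' : BondConfig (Site 3) | ((Nat.sqrt (n ^ 3) : ℕ) : ℝ) ≤
        (((box 3 n).filter fun v => ω' ∈ openConnIn ↑(box 3 n) x v).card : ℝ)}.indicator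
        (fun _ => (1 : ℝ)) ω := by
  obtain ⟨u, _, htu⟩ := hω
  set F : Finset (Site 3) := (box 3 n).filter fun v => ω ∈ openConnIn ↑(box 3 n) u v with hF
  -- every `x ∈ F` is fat: `F ⊆ C_n(x)`
  have hfat : ∀ x ∈ F, ((Nat.sqrt (n ^ 3) : ℕ) : ℝ) ≤
      (((box 3 n).filter fun v => ω ∈ openConnIn ↑(box 3 n) x v).card : ℝ) := by
    intro x hx
    have hux : ω ∈ openConnIn (↑(box 3 n) : Set (Site 3)) u x := (Finset.mem_filter.1 hx).2
    have hsub : F ⊆ (box 3 n).filter fun v => ω ∈ openConnIn ↑(box 3 n) x v := by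
      intro v hv
      obtain ⟨hvbox, huv⟩ := Finset.mem_filter.1 hv
      refine Finset.mem_filter.2 ⟨hvbox, ?_⟩
      obtain ⟨hu', hx', hr⟩ := hux
      obtain ⟨_, hv', hr'⟩ := huv
      exact ⟨hx', hv', hr.symm.trans hr'⟩
    have hcard : (F.card : ℝ) ≤
        (((box 3 n).filter fun v => ω ∈ openConnIn ↑(box 3 n) x v).card : ℝ) := by
      exact_mod_cast Finset.card_le_card hsub
    exact ht.trans (htu.trans hcard)
  have hFsub : F ⊆ box 3 n := Finset.filter_subset _ _
  calc t ≤ (F.card : ℝ) := htu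
    _ = ∑ x ∈ F, (1 : ℝ) := by simp
    _ = ∑ x ∈ F, {ω' : BondConfig (Site 3) | ((Nat.sqrt (n ^ 3) : ℕ) : ℝ) ≤
          (((box 3 n).filter fun v => ω' ∈ openConnIn ↑(box 3 n) x v).card : ℝ)}.indicator
          (fun _ => (1 : ℝ)) ω := by
        refine Finset.sum_congr rfl fun x hx => ?_
        have hmem : ω ∈ {ω' : BondConfig (Site 3) | ((Nat.sqrt (n ^ 3) : ℕ) : ℝ) ≤
            (((box 3 n).filter fun v => ω' ∈ openConnIn ↑(box 3 n) x v).card : ℝ)} := hfat x hx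
        rw [Set.indicator_of_mem hmem]
    _ ≤ ∑ x ∈ box 3 n, {ω' : BondConfig (Site 3) | ((Nat.sqrt (n ^ 3) : ℕ) : ℝ) ≤
          (((box 3 n).filter fun v => ω' ∈ openConnIn ↑(box 3 n) x v).card : ℝ)}.indicator
          (fun _ => (1 : ℝ)) ω :=
        Finset.sum_le_sum_of_subset_of_nonneg hFsub fun x _ _ =>
          Set.indicator_nonneg (fun _ _ => zero_le_one) _

/-- **First-moment Markov bound** (every `p`): for `t > 0` with `t ≥ ⌊√(n³)⌋`,
`P_p(QG(n, t)) ≤ t⁻¹ · Σ_{x ∈ Λ_n} P_p(|C_n(x)| ≥ ⌊√(n³)⌋)`. -/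
theorem measureReal_quasiGiant_le_sum_div (p : unitInterval) (n : ℕ) {t : ℝ} (ht0 : 0 < t)
    (ht : ((Nat.sqrt (n ^ 3) : ℕ) : ℝ) ≤ t) :
    (bondPercolation (zdGraph 3) p).real
        {ω | ∃ u ∈ box 3 n,
          t ≤ (((box 3 n).filter fun v => ω ∈ openConnIn ↑(box 3 n) u v).card : ℝ)}
      ≤ (∑ x ∈ box 3 n, (bondPercolation (zdGraph 3) p).real
          {ω | ((Nat.sqrt (n ^ 3) : ℕ) : ℝ) ≤
            (((box 3 n).filter fun v => ω ∈ openConnIn ↑(box 3 n) x v).card : ℝ)}) / t := by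
  set μ := bondPercolation (zdGraph 3) p with hμ
  set G : Site 3 → Set (BondConfig (Site 3)) := fun x =>
    {ω | ((Nat.sqrt (n ^ 3) : ℕ) : ℝ) ≤
      (((box 3 n).filter fun v => ω ∈ openConnIn ↑(box 3 n) x v).card : ℝ)} with hG
  have hmeas : ∀ x : Site 3, MeasurableSet (G x) := fun x =>
    FreeBoxPowerSavingNegative.TightnessCollapse.measurableSet_le_card_pieceIn n x _
  have hint : ∀ x : Site 3, Integrable (fun ω => (G x).indicator (fun _ => (1 : ℝ)) ω) μ :=
    fun x => (integrable_const (1 : ℝ)).indicator (hmeas x)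
  have hN_int : Integrable (fun ω => ∑ x ∈ box 3 n, (G x).indicator (fun _ => (1 : ℝ)) ω) μ :=
    integrable_finsetSum _ fun x _ => hint x
  have hN_nonneg : 0 ≤ᵐ[μ] fun ω => ∑ x ∈ box 3 n, (G x).indicator (fun _ => (1 : ℝ)) ω :=
    ae_of_all _ fun ω => Finset.sum_nonneg fun x _ =>
      Set.indicator_nonneg (fun _ _ => zero_le_one) _
  have hN_integral : ∫ ω, (∑ x ∈ box 3 n, (G x).indicator (fun _ => (1 : ℝ)) ω) ∂μ =
      ∑ x ∈ box 3 n, μ.real (G x) := by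
    rw [integral_finsetSum _ fun x _ => hint x]
    refine Finset.sum_congr rfl fun x _ => ?_
    rw [integral_indicator_const (1 : ℝ) (hmeas x), smul_eq_mul, mul_one]
  have hmarkov := mul_meas_ge_le_integral_of_nonneg hN_nonneg hN_int t
  rw [hN_integral] at hmarkov
  have hsub : {ω | ∃ u ∈ box 3 n,
        t ≤ (((box 3 n).filter fun v => ω ∈ openConnIn ↑(box 3 n) u v).card : ℝ)} ⊆
      {ω | t ≤ ∑ x ∈ box 3 n, (G x).indicator (fun _ => (1 : ℝ)) ω} :=
    fun ω hω => le_sum_indicator ht hω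
  calc μ.real {ω | ∃ u ∈ box 3 n,
          t ≤ (((box 3 n).filter fun v => ω ∈ openConnIn ↑(box 3 n) u v).card : ℝ)}
      ≤ μ.real {ω | t ≤ ∑ x ∈ box 3 n, (G x).indicator (fun _ => (1 : ℝ)) ω} :=
        measureReal_mono hsub (measure_ne_top _ _)
    _ ≤ (∑ x ∈ box 3 n, μ.real (G x)) / t := by
        rw [le_div_iff₀ ht0, mul_comm]
        exact hmarkov

/-- `⌊√(n³)⌋ ≤ n²` (as `n³ ≤ (n²)²` for `n ≥ 1`; trivial for `n = 0`). -/
theorem sqrt_cube_le_sq (n : ℕ) : Nat.sqrt (n ^ 3) ≤ n ^ 2 := by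
  rcases Nat.eq_zero_or_pos n with rfl | hn
  · simp
  · calc Nat.sqrt (n ^ 3) ≤ Nat.sqrt ((n ^ 2) ^ 2) :=
          Nat.sqrt_le_sqrt (by rw [← pow_mul]; exact Nat.pow_le_pow_right hn (by norm_num))
      _ = n ^ 2 := Nat.sqrt_eq' _

/-- The 6982-event at `x` contains the "fat piece at `x`" event (take `T := C_n(x)`). -/
theorem setOf_le_card_subset (n : ℕ) (x : Site 3) :
    {ω : BondConfig (Site 3) | ((Nat.sqrt (n ^ 3) : ℕ) : ℝ) ≤
        (((box 3 n).filter fun v => ω ∈ openConnIn ↑(box 3 n) x v).card : ℝ)} ⊆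
      {ω | ∃ T : Finset (Site 3), Nat.sqrt (n ^ 3) ≤ T.card ∧
        ∀ y ∈ T, ω ∈ openConnIn (↑(box 3 n) : Set (Site 3)) x y} := by
  intro ω hω
  refine ⟨(box 3 n).filter fun v => ω ∈ openConnIn ↑(box 3 n) x v, by exact_mod_cast hω, ?_⟩
  intro y hy
  exact (Finset.mem_filter.1 hy).2

/-- **stmt-6982 ⟹ QG-NAS** (the one-bit hypothesis of the landed `stub_logBoost`, verbatim, with
`ε = 1/2`): if `Σ_{x ∈ Λ_R} P_{p_c}(|C_R(x)| ≥ ⌊√(R³)⌋) ≤ C R^{3-δ}` (`R ≥ 1`, `δ > 0`), then with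
`a = min δ 2 / 2`, eventually `P_{p_c}(QG(n, n^{3-a})) ≤ C n^{-a} ≤ 1/2`. -/
theorem quasiGiantNotAS_of_freeBoxFatClusterMass
    (h : Summit.CriticalPhenomena.PercolationContinuityZ3.Theses.PercBoundarySqueeze.FreeBoxFatClusterMass) :
    ∃ a ε : ℝ, 0 < a ∧ 0 < ε ∧ ∀ᶠ n : ℕ in atTop,
      (bondPercolation (zdGraph 3) (criticalProbI 3)).real
          {ω | ∃ u ∈ box 3 n,
            (n : ℝ) ^ (3 - a) ≤
              (((box 3 n).filter fun v => ω ∈ openConnIn ↑(box 3 n) u v).card : ℝ)}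
        ≤ 1 - ε := by
  obtain ⟨δ, C, hδ, hC⟩ := h
  set d : ℝ := min δ 2 with hd
  have hd0 : 0 < d := lt_min hδ (by norm_num)
  have hdδ : d ≤ δ := min_le_left _ _
  have hd2 : d ≤ 2 := min_le_right _ _
  set a : ℝ := d / 2 with ha
  have ha0 : 0 < a := by positivity
  have ha1 : a ≤ 1 := by rw [ha]; linarith
  refine ⟨a, 1 / 2, ha0, by norm_num, ?_⟩
  -- `C n^{-a} → 0`
  have hlim : Tendsto (fun n : ℕ => max C 0 * (n : ℝ) ^ (-a)) atTop (𝓝 0) := by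
    have h := ((tendsto_rpow_neg_atTop ha0).comp tendsto_natCast_atTop_atTop).const_mul (max C 0)
    simpa using h
  have hsmall : ∀ᶠ n : ℕ in atTop, max C 0 * (n : ℝ) ^ (-a) ≤ 1 / 2 :=
    hlim.eventually (ge_mem_nhds (by norm_num))
  filter_upwards [hsmall, eventually_ge_atTop 1] with n hsm hn1
  have hN1 : (1 : ℝ) ≤ n := by exact_mod_cast hn1
  have hN0 : (0 : ℝ) < n := by linarith
  have ht0 : 0 < (n : ℝ) ^ (3 - a) := Real.rpow_pos_of_pos hN0 _
  -- threshold `n^{3-a} ≥ n² ≥ ⌊√(n³)⌋`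
  have ht : ((Nat.sqrt (n ^ 3) : ℕ) : ℝ) ≤ (n : ℝ) ^ (3 - a) := by
    have h1 : ((Nat.sqrt (n ^ 3) : ℕ) : ℝ) ≤ ((n ^ 2 : ℕ) : ℝ) := by
      exact_mod_cast sqrt_cube_le_sq n
    have h2 : ((n ^ 2 : ℕ) : ℝ) = (n : ℝ) ^ (2 : ℝ) := by
      push_cast
      rw [show (2 : ℝ) = ((2 : ℕ) : ℝ) by norm_num, Real.rpow_natCast]
    have h3 : (n : ℝ) ^ (2 : ℝ) ≤ (n : ℝ) ^ (3 - a) :=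
      Real.rpow_le_rpow_of_exponent_le hN1 (by linarith)
    linarith
  have hsum := hC n hn1
  calc (bondPercolation (zdGraph 3) (criticalProbI 3)).real
        {ω | ∃ u ∈ box 3 n, (n : ℝ) ^ (3 - a) ≤
          (((box 3 n).filter fun v => ω ∈ openConnIn ↑(box 3 n) u v).card : ℝ)}
      ≤ (∑ x ∈ box 3 n, (bondPercolation (zdGraph 3) (criticalProbI 3)).real
          {ω | ((Nat.sqrt (n ^ 3) : ℕ) : ℝ) ≤
            (((box 3 n).filter fun v => ω ∈ openConnIn ↑(box 3 n) x v).card : ℝ)}) /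
          (n : ℝ) ^ (3 - a) :=
        measureReal_quasiGiant_le_sum_div (criticalProbI 3) n ht0 ht
    _ ≤ (C * (n : ℝ) ^ ((3 : ℝ) - δ)) / (n : ℝ) ^ (3 - a) := by
        gcongr
        refine le_trans (Finset.sum_le_sum fun x _ => ?_) hsum
        exact measureReal_mono (setOf_le_card_subset n x) (measure_ne_top _ _)
    _ ≤ (max C 0 * (n : ℝ) ^ ((3 : ℝ) - δ)) / (n : ℝ) ^ (3 - a) := by
        gcongr
        exact le_max_left _ _
    _ = max C 0 * (n : ℝ) ^ ((3 - δ) - (3 - a)) := by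
        rw [mul_div_assoc, ← Real.rpow_sub hN0]
    _ ≤ max C 0 * (n : ℝ) ^ (-a) := by
        apply mul_le_mul_of_nonneg_left _ (le_max_right _ _)
        exact Real.rpow_le_rpow_of_exponent_le hN1 (by rw [ha]; linarith)
    _ ≤ 1 / 2 := hsm
    _ = 1 - 1 / 2 := by norm_num

end OfFatClusterMass

/-- **`PercBoundarySqueeze.FreeBoxFatClusterMass` (stmt-CriticalPhenomena-6982) implies the crux
`PercNonProliferation.FreeBoxPowerSaving` (stmt-CriticalPhenomena-4447).**  Compose
`OfFatClusterMass.quasiGiantNotAS_of_freeBoxFatClusterMass` (QG-NAS at `p_c`) with the landed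
`stub_logBoost` (p79965; its size-splitting hypothesis is the landed `stub_sizeSplitting`, p77722)
and the landed normal form `FreeBoxPowerSavingNegative.of_eventually` (p73056). -/
theorem freeBoxPowerSaving_of_freeBoxFatClusterMass :
    Summit.CriticalPhenomena.PercolationContinuityZ3.Theses.PercBoundarySqueeze.FreeBoxFatClusterMass →
      Summit.CriticalPhenomena.PercolationContinuityZ3.Theses.PercNonProliferation.FreeBoxPowerSaving := by
  intro h
  obtain ⟨a, ε, ha, hε, hev⟩ := OfFatClusterMass.quasiGiantNotAS_of_freeBoxFatClusterMass h
  obtain ⟨a', C, ha', hev'⟩ :=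
    stub_logBoost (criticalProbI 3) (stub_sizeSplitting (criticalProbI 3)) a ε ha hε hev
  obtain ⟨C', hC'⟩ := FreeBoxPowerSavingNegative.of_eventually ha' hev'
  exact ⟨a', C', ha', fun n hn => hC' n hn⟩

end Summit.CriticalPhenomena.PercolationContinuityZ3.FreeBoxPowerSavingLine

end
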